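import Summits.QuantumFields.BalabanUV.Beta.EriceFlowEnclosureInverseLawFiveHalves

/-!
# Beta / EriceFlowEnclosureInverseLawModulus — INVERSION OF A LOGARITHMIC LAW UNDER AN ARBITRARY REMAINDER MODULUS (pure SERVICE; the
# inversion twin of P2 #46-A `EriceFlowEnclosureLambdaThreeLoopModulus`).  From
#        **`|Λ t − 1∕t − κ·log t − C − a·t| ≤ t·ω(t)` on ]0, t₁[,  ω ≥ 0 non-decreasing,**
# and an eventual right inverse σ → 0⁺ with `y·σ y → 1`:
#        **eventually |1∕σ y − y − κ·log y + C − κ²·(log y)∕y + (κ·C + a)∕y| ≤ A⁗·(1 + log y)²∕y² + 2·ω(2∕y)∕y**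
# — ONE inversion lemma for the whole modulus scale: ω = A·t(1 + |log t|)² is P2 #36c `inverse_law_third` (road (S)∕(T₃)), ω = A√t is P2 #44e
# `inverse_law_fiveHalves` (road (G)), and a LITTLE-o modulus (ω → 0 at 0⁺) gives the running coupling's 1∕y letter −(κC + a) with error
# o(1∕y) (`inverse_law_littleO`) — consumed by P2 #46c `EriceFlowEnclosureRunningCouplingPeano` (the letter from a second PEANO derivative of the
# limit β at 0⁺); the letter is FORCED at this precision (`invLetter_unique_littleO`)
# (β-flow team, prover 2 = lower ∕ positivity side, unit `b2b-balaban-beta-bflow-p2`, gen 29; module P2 #46b over P2 #36c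
# `EriceFlowEnclosureInverseLawThird` (its exact rearrangement `inverse_third_identity` and five-term bound `inverse_third_remainder_le` with the
# E₃-slot set to zero, `abs_log_sub_le_of_inv_eq`) and P2 #44-A `EriceFlowEnclosureModulusTails` (`logSq_div_sq_le_inv_sqrt`), both reached
# through P2 #44e `EriceFlowEnclosureInverseLawFiveHalves`)

HONEST FRAMING (page 1 of everything the β sub-cell writes): discharging `BetaPertH` makes Bałaban's UV stability UNCONDITIONAL — a
real constructive-QFT result; it is NOT the continuum limit and NOT the Clay problem.  HONEST DEPENDENCY (cell reorg 2026-08-19,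
verbatim): «continuum YM on T⁴ ⇐ BetaPertH ∧ nine spine estimates (0/9 proved); BetaPertH ⇐ (D1) ∧ (D4) ∧ CAP+tail; G-an2-4 gates
asym, D1 and NE2/3/4.»  THIS MODULE DISCHARGES NOTHING and quotes nothing: [folklore] real analysis about three real functions Λ, σ, ω
and four real letters; no Erice sentence occurs (the consumer P2 #46c supplies the Λ-law from the Peano condition).

THE POINT.  P2 #36c's route at t = σ y: E := y − 1∕t − κ log t − C = a·t + E₃, now with |E₃| ≤ t·ω(t) ≤ (2∕y)·ω(2∕y) (t ≤ 2∕y and ω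
MONOTONE — the one place monotonicity is used) and the constant majorant ω ≤ W := ω(t₁∕2) on ]0, t₁∕2] (monotone again; no boundedness
hypothesis); u := (C + κ log t + E)∕y, 1∕(yt) = 1 − u, log(yt) = u + r, |r| ≤ 2u²; the exact rearrangement `inverse_third_identity` leaves
`−κ²(u + r)∕y − κE∕y − κr − a·t·u − E₃`; the first four terms are ≤ A⁗·(1 + log y)²∕y² by `inverse_third_remainder_le` (E₃-slot := 0,
A₀ = 2|a| + 2W, B = |C| + |κ| + A₀), and |E₃| ≤ 2ω(2∕y)∕y rides separately.  §2: if moreover ω → 0 at 0⁺ then y·(…) → 0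
((1 + log y)²∕y ≤ 16∕√y by `logSq_div_sq_le_inv_sqrt`, and ω(2∕y) → 0).

WHAT THIS FILE PROVES (0 sorry, 0 def): HEADLINE **`inverse_law_modulus`** (statement above; A⁗ = κ²B + κ²B² + |κ|A₀ + 2|κ|B² + 2|a|B with
A₀ = 2|a| + 2·ω(t₁∕2), B = |C| + |κ| + A₀, DISPLAYED), **`inverse_law_littleO`** (ω → 0 ⟹ `y·(1∕σ y − y − κ·log y + C − κ²·(log y)∕y +
(κ·C + a)∕y) → 0`), and **`invLetter_unique_littleO`** (two expansions `b∕y + o(1∕y)` of one function agree: the 1∕y letter is FORCED at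
precision o(1∕y)).
NOT CLAIMED: the Λ-law itself (a HYPOTHESIS here); anything about (1.22); `BetaPertH`; continuum; Clay.
-/

namespace Summit.QuantumFields.BalabanUV.Beta.EriceFlowEnclosureInverseLawModulus

open Set Filter Topology
open Summit.QuantumFields.BalabanUV.Beta.EriceFlowEnclosureInverseLawThird (abs_log_sub_le_of_inv_eq inverse_third_identity
  inverse_third_remainder_le)
open Summit.QuantumFields.BalabanUV.Beta.EriceFlowEnclosureModulusTails (logSq_div_sq_le_inv_sqrt)

noncomputable section

/-! ## §1 Inversion under a monotone remainder modulus -/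

/-- **INVERSION UNDER A MONOTONE REMAINDER MODULUS (HEADLINE; pure real analysis): the coefficient of 1∕y is −(κC + a), error
`A⁗·(1 + log y)²∕y² + 2·ω(2∕y)∕y`.**  If `|Λ t − 1∕t − κ·log t − C − a·t| ≤ t·ω t` on ]0, t₁[ (t₁ > 0) with `ω ≥ 0` NON-DECREASING on ]0, t₁[,
σ is an eventual right inverse of Λ with `σ y → 0⁺` and `y·σ y → 1`, then eventually
`|1∕σ y − y − κ·log y + C − κ²·(log y)∕y + (κ·C + a)∕y| ≤ A⁗·((1 + log y)²∕y²) + 2·ω(2∕y)∕y`,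
A⁗ = κ²B + κ²B² + |κ|A₀ + 2|κ|B² + 2|a|B, A₀ = 2|a| + 2·ω(t₁∕2), B = |C| + |κ| + A₀ — P2 #36c `inverse_law_third` re-run with the E₃-bracket
`|E₃| ≤ t·ω(t) ≤ (2∕y)·ω(2∕y)` (t ≤ 2∕y ≤ t₁∕2, ω monotone). [folklore] -/
theorem inverse_law_modulus {Λ σ ω : ℝ → ℝ} {κ C a t₁ : ℝ}
    (hlaw : ∀ t ∈ Ioo 0 t₁, |Λ t - 1 / t - κ * Real.log t - C - a * t| ≤ t * ω t)
    (hω0 : ∀ t ∈ Ioo 0 t₁, 0 ≤ ω t) (hωmono : MonotoneOn ω (Ioo 0 t₁))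
    (hσ0 : Tendsto σ atTop (𝓝[>] 0)) (hσ : ∀ᶠ y in atTop, Λ (σ y) = y)
    (hone : Tendsto (fun y => y * σ y) atTop (𝓝 1)) (ht₁ : 0 < t₁) :
    ∀ᶠ y in atTop, |1 / σ y - y - κ * Real.log y + C - κ ^ 2 * Real.log y / y + (κ * C + a) / y|
      ≤ (κ ^ 2 * (|C| + |κ| + (2 * |a| + 2 * ω (t₁ / 2))) + κ ^ 2 * (|C| + |κ| + (2 * |a| + 2 * ω (t₁ / 2))) ^ 2
          + |κ| * (2 * |a| + 2 * ω (t₁ / 2)) + 2 * |κ| * (|C| + |κ| + (2 * |a| + 2 * ω (t₁ / 2))) ^ 2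
          + 2 * |a| * (|C| + |κ| + (2 * |a| + 2 * ω (t₁ / 2)))) * ((1 + Real.log y) ^ 2 / y ^ 2)
        + 2 * ω (2 / y) / y := by
  -- adapted from P2 #44e `EriceFlowEnclosureInverseLawFiveHalves.inverse_law_fiveHalves` (same letters; E₃-bracket and the final merge differ)
  have ht₁2 : 0 < t₁ / 2 := by positivity
  have hmid : t₁ / 2 ∈ Ioo 0 t₁ := ⟨ht₁2, by linarith⟩
  set W : ℝ := ω (t₁ / 2) with hW
  have hW0 : 0 ≤ W := hω0 _ hmid
  have hmem : ∀ᶠ y in atTop, σ y ∈ Ioo 0 t₁ := hσ0 (Ioo_mem_nhdsGT ht₁)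
  have hlo : ∀ᶠ y in atTop, 1 / 2 < y * σ y := hone.eventually (lt_mem_nhds (by norm_num))
  have hhi : ∀ᶠ y in atTop, y * σ y < 2 := hone.eventually (gt_mem_nhds (by norm_num))
  have hyt₁ : ∀ᶠ y : ℝ in atTop, 4 / t₁ ≤ y := eventually_ge_atTop _
  obtain ⟨A₀, hA₀⟩ : ∃ A₀ : ℝ, A₀ = 2 * |a| + 2 * W := ⟨_, rfl⟩
  obtain ⟨B, hB⟩ : ∃ B : ℝ, B = |C| + |κ| + A₀ := ⟨_, rfl⟩
  have hA₀nn : 0 ≤ A₀ := by rw [hA₀]; positivity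
  have hB0 : 0 ≤ B := by rw [hB]; positivity
  have hsmallu : ∀ᶠ y : ℝ in atTop, B * (1 + Real.log y) / y ≤ 1 / 2 := by
    have hlogdiv : Tendsto (fun y : ℝ => Real.log y / y) atTop (𝓝 0) := Real.isLittleO_log_id_atTop.tendsto_div_nhds_zero
    have hinv : Tendsto (fun y : ℝ => 1 / y) atTop (𝓝 0) := tendsto_const_nhds.div_atTop tendsto_id
    have h : Tendsto (fun y : ℝ => B * (1 / y + Real.log y / y)) atTop (𝓝 0) := by
      have := (hinv.add hlogdiv).const_mul B; rwa [add_zero, mul_zero] at this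
    have h2 := h.eventually (gt_mem_nhds (by norm_num : (0:ℝ) < 1 / 2))
    filter_upwards [h2, eventually_gt_atTop (0:ℝ)] with y hy hy0
    have e : B * (1 + Real.log y) / y = B * (1 / y + Real.log y / y) := by field_simp
    rw [e]; exact hy.le
  filter_upwards [hmem, hσ, hlo, hhi, eventually_ge_atTop (2 : ℝ), hsmallu, hyt₁] with y ht he hlo hhi hy2 hsu hy4
  set t := σ y with htdef
  have ht0 : 0 < t := ht.1
  have hy0 : 0 < y := by linarith
  have hy1 : (1 : ℝ) ≤ y := by linarith
  have hlogy : 0 ≤ Real.log y := Real.log_nonneg (by linarith)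
  obtain ⟨L, hL⟩ : ∃ L : ℝ, L = 1 + Real.log y := ⟨_, rfl⟩
  have hL1 : 1 ≤ L := by rw [hL]; linarith
  have hLaw := hlaw t ht
  rw [he] at hLaw
  have ht_le : t ≤ 2 / y := by rw [le_div_iff₀ hy0]; linarith
  have ht_ge : 1 / (2 * y) ≤ t := by rw [div_le_iff₀ (by linarith)]; linarith
  have htle1 : t ≤ 1 := ht_le.trans (by rw [div_le_one hy0]; linarith)
  -- 2∕y ≤ t₁∕2 < t₁: the point 2∕y is in the monotonicity domain and below the majorant's anchor
  have h2y : 2 / y ≤ t₁ / 2 := by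
    rw [div_le_iff₀ hy0]
    have := (div_le_iff₀ ht₁).mp hy4
    linarith
  have h2ymem : 2 / y ∈ Ioo 0 t₁ := ⟨by positivity, by linarith⟩
  have hωt : ω t ≤ ω (2 / y) := hωmono ht h2ymem ht_le
  have hω2W : ω (2 / y) ≤ W := hωmono h2ymem hmid h2y
  have hω2y0 : 0 ≤ ω (2 / y) := hω0 _ h2ymem
  have hlogt : |Real.log t| ≤ Real.log y + 1 := by
    have hneg : Real.log t ≤ 0 := Real.log_nonpos ht0.le htle1
    rw [abs_of_nonpos hneg]
    have h1 : Real.log (1 / (2 * y)) ≤ Real.log t := Real.log_le_log (by positivity) ht_ge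
    rw [one_div, Real.log_inv, Real.log_mul (by norm_num) hy0.ne'] at h1
    have h2 : Real.log 2 ≤ 1 := by
      have := Real.log_le_sub_one_of_pos (by norm_num : (0:ℝ) < 2); linarith
    linarith
  -- letters E, E₃, u, r
  set E : ℝ := y - 1 / t - κ * Real.log t - C with hE
  set E₃ : ℝ := E - a * t with hE₃
  set u : ℝ := (C + κ * Real.log t + E) / y with hu
  set r : ℝ := Real.log (y * t) - u with hr
  have hE₃b : |E₃| ≤ 2 * ω (2 / y) / y := by
    have h0 : E₃ = y - 1 / t - κ * Real.log t - C - a * t := by simp only [hE₃, hE]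
    rw [h0]
    calc |y - 1 / t - κ * Real.log t - C - a * t| ≤ t * ω t := hLaw
      _ ≤ (2 / y) * ω (2 / y) := mul_le_mul ht_le hωt (hω0 t ht) (by positivity)
      _ = 2 * ω (2 / y) / y := by ring
  have hE₃b' : |E₃| ≤ 2 * W / y := by
    refine hE₃b.trans ?_
    exact div_le_div_of_nonneg_right (by linarith) hy0.le
  have hEb : |E| ≤ A₀ / y := by
    have h0 : E = a * t + E₃ := by simp only [hE₃]; ring
    rw [h0, hA₀]
    calc |a * t + E₃| ≤ |a * t| + |E₃| := abs_add_le _ _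
      _ ≤ |a| * (2 / y) + 2 * W / y := by
          rw [abs_mul, abs_of_pos ht0]
          exact add_le_add (mul_le_mul_of_nonneg_left ht_le (abs_nonneg a)) hE₃b'
      _ = (2 * |a| + 2 * W) / y := by ring
  have hEb' : |E| ≤ A₀ := hEb.trans (by rw [div_le_iff₀ hy0]; nlinarith)
  have hub : |u| ≤ B * L / y := by
    rw [hu, abs_div, abs_of_pos hy0]
    refine div_le_div_of_nonneg_right ?_ hy0.le
    calc |C + κ * Real.log t + E| ≤ |C| + |κ * Real.log t| + |E| := abs_add_three _ _ _
      _ ≤ |C| + |κ| * (Real.log y + 1) + A₀ := by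
          rw [abs_mul]; exact add_le_add (add_le_add le_rfl (mul_le_mul_of_nonneg_left hlogt (abs_nonneg _))) hEb'
      _ ≤ B * L := by
          rw [hB, hL]; nlinarith [abs_nonneg C, abs_nonneg κ, mul_nonneg (abs_nonneg C) hlogy, mul_nonneg hA₀nn hlogy]
  have hu_half : |u| ≤ 1 / 2 := hub.trans (by rw [hL]; exact hsu)
  -- 1∕(y t) = 1 − u, log(y t) = u + r with |r| ≤ 2u²
  have hinvw : 1 / (y * t) = 1 - u := by
    have : 1 / t = y - C - κ * Real.log t - E := by simp only [hE]; ring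
    rw [hu, one_div, mul_inv, ← one_div t, this]
    field_simp
    ring
  have hrb : |r| ≤ 2 * B ^ 2 * L ^ 2 / y ^ 2 := by
    have h1 : u ^ 2 ≤ (B * L / y) ^ 2 := by
      rw [← sq_abs u]; exact pow_le_pow_left₀ (abs_nonneg _) hub 2
    calc |r| = |Real.log (y * t) - u| := by rw [hr]
      _ ≤ 2 * u ^ 2 := abs_log_sub_le_of_inv_eq hinvw hu_half
      _ ≤ 2 * (B * L / y) ^ 2 := by linarith
      _ = 2 * B ^ 2 * L ^ 2 / y ^ 2 := by rw [div_pow, mul_pow]; ring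
  rw [inverse_third_identity (κ := κ) (C := C) (a := a) ht0 hy0 hE hu hr hE₃]
  -- the four-term part by P2 #36c's abstract bound with the E₃-slot set to zero, plus |E₃| separately
  have hmain := inverse_third_remainder_le (κ := κ) (a := a) (E₃ := 0) (A := 0) hy2 ht0 ht_le hL1 hB0 hA₀nn hub hrb hEb
    (by rw [abs_zero]; positivity)
  rw [sub_zero] at hmain
  have hsplit : |-(κ ^ 2 * (u + r) / y) - κ * E / y - κ * r - a * t * u - E₃|
      ≤ |-(κ ^ 2 * (u + r) / y) - κ * E / y - κ * r - a * t * u| + |E₃| := abs_sub _ _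
  refine hsplit.trans ?_
  have hfour : |-(κ ^ 2 * (u + r) / y) - κ * E / y - κ * r - a * t * u|
      ≤ (κ ^ 2 * B + κ ^ 2 * B ^ 2 + |κ| * A₀ + 2 * |κ| * B ^ 2 + 2 * |a| * B) * (L ^ 2 / y ^ 2) := by
    refine hmain.trans (le_of_eq ?_)
    ring
  have := add_le_add hfour hE₃b
  refine this.trans (le_of_eq ?_)
  rw [hB, hA₀, hL]

/-! ## §2 A little-o modulus gives the 1∕y letter with error o(1∕y), and the letter is forced -/

/-- **THE 1∕y LETTER UNDER A LITTLE-o MODULUS.**  If `|Λ t − 1∕t − κ·log t − C − a·t| ≤ t·ω t` on ]0, t₁[ with `ω ≥ 0` non-decreasing on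
]0, t₁[ and **`ω → 0` at 0⁺**, σ an eventual right inverse of Λ with `σ y → 0⁺` and `y·σ y → 1`, then
**`y·(1∕σ y − y − κ·log y + C − κ²·(log y)∕y + (κ·C + a)∕y) → 0` as `y → ∞`** — READING (ours): 1∕g²(y) = y + κ·log y − C + κ²·(log y)∕y
− (κC + a)∕y + o(1∕y); by §1 (`(1 + log y)²∕y ≤ 16∕√y → 0` and `ω(2∕y) → 0`). [folklore] -/
theorem inverse_law_littleO {Λ σ ω : ℝ → ℝ} {κ C a t₁ : ℝ}
    (hlaw : ∀ t ∈ Ioo 0 t₁, |Λ t - 1 / t - κ * Real.log t - C - a * t| ≤ t * ω t)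
    (hω0 : ∀ t ∈ Ioo 0 t₁, 0 ≤ ω t) (hωmono : MonotoneOn ω (Ioo 0 t₁)) (hωlim : Tendsto ω (𝓝[>] 0) (𝓝 0))
    (hσ0 : Tendsto σ atTop (𝓝[>] 0)) (hσ : ∀ᶠ y in atTop, Λ (σ y) = y)
    (hone : Tendsto (fun y => y * σ y) atTop (𝓝 1)) (ht₁ : 0 < t₁) :
    Tendsto (fun y => y * (1 / σ y - y - κ * Real.log y + C - κ ^ 2 * Real.log y / y + (κ * C + a) / y)) atTop (𝓝 0) := by
  have h1 := inverse_law_modulus (κ := κ) (C := C) (a := a) hlaw hω0 hωmono hσ0 hσ hone ht₁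
  set A4 : ℝ := κ ^ 2 * (|C| + |κ| + (2 * |a| + 2 * ω (t₁ / 2))) + κ ^ 2 * (|C| + |κ| + (2 * |a| + 2 * ω (t₁ / 2))) ^ 2
      + |κ| * (2 * |a| + 2 * ω (t₁ / 2)) + 2 * |κ| * (|C| + |κ| + (2 * |a| + 2 * ω (t₁ / 2))) ^ 2
      + 2 * |a| * (|C| + |κ| + (2 * |a| + 2 * ω (t₁ / 2))) with hA4
  have hW0 : 0 ≤ ω (t₁ / 2) := hω0 _ ⟨by positivity, by linarith⟩
  have hA40 : 0 ≤ A4 := by positivity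
  -- the majorant y ↦ A4·16∕√y + 2·ω(2∕y) → 0
  have h2y : Tendsto (fun y : ℝ => 2 / y) atTop (𝓝[>] 0) := by
    refine tendsto_nhdsWithin_iff.mpr ⟨tendsto_const_nhds.div_atTop tendsto_id, ?_⟩
    filter_upwards [eventually_gt_atTop (0 : ℝ)] with y hy
    exact div_pos two_pos hy
  have hω2 : Tendsto (fun y : ℝ => ω (2 / y)) atTop (𝓝 0) := hωlim.comp h2y
  have hsq : Tendsto (fun y : ℝ => A4 * (16 * (Real.sqrt y)⁻¹)) atTop (𝓝 0) := by
    have h := (tendsto_inv_atTop_zero.comp Real.tendsto_sqrt_atTop).const_mul 16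
    have h' := h.const_mul A4
    simpa using h'
  have hmaj : Tendsto (fun y : ℝ => A4 * (16 * (Real.sqrt y)⁻¹) + 2 * ω (2 / y)) atTop (𝓝 0) := by
    have := hsq.add (hω2.const_mul 2)
    rwa [mul_zero, add_zero] at this
  refine squeeze_zero_norm' ?_ hmaj
  filter_upwards [h1, eventually_ge_atTop (1 : ℝ)] with y hy hy1
  have hy0 : 0 < y := by linarith
  have hsy : 0 < Real.sqrt y := Real.sqrt_pos.mpr hy0
  rw [norm_mul, Real.norm_eq_abs, Real.norm_eq_abs, abs_of_pos hy0]
  have hL2 : (1 + Real.log y) ^ 2 / y ^ 2 ≤ 16 / (y * Real.sqrt y) := logSq_div_sq_le_inv_sqrt hy1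
  calc y * |1 / σ y - y - κ * Real.log y + C - κ ^ 2 * Real.log y / y + (κ * C + a) / y|
      ≤ y * (A4 * ((1 + Real.log y) ^ 2 / y ^ 2) + 2 * ω (2 / y) / y) := mul_le_mul_of_nonneg_left hy hy0.le
    _ ≤ y * (A4 * (16 / (y * Real.sqrt y)) + 2 * ω (2 / y) / y) := by
        refine mul_le_mul_of_nonneg_left (add_le_add (mul_le_mul_of_nonneg_left hL2 hA40) le_rfl) hy0.le
    _ = A4 * (16 * (Real.sqrt y)⁻¹) + 2 * ω (2 / y) := by field_simp

/-- **THE 1∕y LETTER IS UNIQUE AT PRECISION o(1∕y)** ([folklore]): if `y·(G y − b∕y) → 0` and `y·(G y − b′∕y) → 0` as y → ∞ then `b = b′`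
(the difference is the constant `b′ − b` for y ≠ 0) — so the letter −(κC + a) of `inverse_law_littleO` is FORCED by the running coupling. -/
theorem invLetter_unique_littleO {G : ℝ → ℝ} {b b' : ℝ}
    (h : Tendsto (fun y => y * (G y - b / y)) atTop (𝓝 0))
    (h' : Tendsto (fun y => y * (G y - b' / y)) atTop (𝓝 0)) : b = b' := by
  have hd := h'.sub h
  rw [sub_zero] at hd
  have hc : Tendsto (fun _ : ℝ => b - b') atTop (𝓝 0) := by
    refine hd.congr' ?_
    filter_upwards [eventually_gt_atTop (0 : ℝ)] with y hy
    have hy0 : y ≠ 0 := ne_of_gt hy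
    field_simp
    ring
  have := tendsto_nhds_unique hc tendsto_const_nhds
  linarith

end

end Summit.QuantumFields.BalabanUV.Beta.EriceFlowEnclosureInverseLawModulus
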